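import Summits.CriticalPhenomena.PercolationContinuityZ3.Theorems.PercNearOneGluingNoHeavyQuantTwoRootGateCoupling
import Summits.CriticalPhenomena.PercolationContinuityZ3.Theorems.PercNearOneGluingNoHeavyQuantReducibleSibling
import Summits.CriticalPhenomena.PercolationContinuityZ3.Theorems.PercNearOneGluingNoHeavyQuantLightPairBlobForest
import Summits.CriticalPhenomena.PercolationContinuityZ3.Theorems.PercNearOneGluingNoHeavyQuantResidueForestsAll
import HarnessLib

/-!
# QUANT lane R8, T-DEC: EVERY WIDTH-2 FOREST OF GLUED SIBLINGS IS SDEC AT ITS NATURAL FLOOR — any shapes `(rᵢ, kᵢ)`, any gates,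
# no oracle; in particular the light glued pair `lpT c q s = (R¹[q](R^c[s]))²` is SDEC at `q·s` for ALL `c, q, s`
# (prim-quant-census-2 gen 79)

builds on p205010 (kernel theorem, internal audit signed; external expert review pending)

Support file (`--supports stmt-CriticalPhenomena-4575`), QUANT lane census seat prim-quant-census-2 (gen 79); memo
`run/shared/lean/prim/quant/prim-quant-census-2-g79/GLUEDPAIR-G79.md`.  Theorems only, standard axioms, no sorries, no definitions.

WHY.  Census-2 g77/g78 settled the light HULL node on the family `lpT c q s` (the product law of two glued siblings
`t = R¹[q](R^c[s]) = {0: 1−q, 1: q(1−s), 1+c: qs}`): hull membership holds on ≈ 87 % of the light square (`sdec_lpT_lowGate/largeGate/bf/…`,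
eight regional theorems) and FAILS in the kernel at the corner (`lpT_corner997_out`, `not_treeBuiltCatHullLight`, `not_catPairLight`,
✓ `…QuantCatHullCertR8Main`).  What the node of record (`SiblingStep`, SDEC of forest laws) says about the SAME family was recorded only
numerically ("DEC at every layer").  This file closes that in the kernel, for every parameter, by the two-root route: arm-1 g45's identity
(`sdec_twoRoot_of_opened`, ✓ `…QuantTwoRootGateCoupling`) needs SDEC of the two sub-forests and of the OPENED forest `ρ₁ ∗ gate_{q₂/q₁} ρ₂`; for glued
siblings the sub-forests are blob laws with a sure part (`blobLaw [(k, g), (r, 1)]`, SDEC at `g` by `sdec_blobLaw`) and the opened forest is a gated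
glued sibling beside a sure block and a heavy blob (`sdec_gate` + `sdec_lconv_blobLaw`) — all kernel, so no oracle remains.

* `blobTop_glued`, `glued_blob_laws`, `blobLaw_glued_eq_sp` — bookkeeping of the sub-forest law `{r: 1−g, r+k: g}` as a blob list.
* **`sdec_gluedTwo`** — for ALL `r₁ k₁ r₂ k₂ : ℕ`, `0 < qᵢ < 1`, `0 < gᵢ < 1` and every floor `0 < x ≤ min(q₁g₁, q₂g₂)`:
  `SDEC x ((r₁+k₁)+(r₂+k₂)) (gate ρ₁ q₁ ∗ gate ρ₂ q₂)`, `ρᵢ = blobLaw [(kᵢ, gᵢ), (rᵢ, 1)]` (`sdec_gluedTwo_of_le` is the case `q₂ ≤ q₁`).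
* **`sdec_lpT_all`** — `SDEC (q·s) (2c+2) (lpT c q s)` for every `c`, `0 < q < 1`, `0 < s < 1` (and `sdec_lpT_all_of_le` at every floor below):
  supersedes the regional `sdec_lpT_*` of census-2 g77 as far as SDEC is concerned (hull MEMBERSHIP stays regional — it is false at the corner).
* **`sdec_flaw_gluedTwo`** — the same on the node's binder: `SDEC x (ftop [s₁, s₂]) (flaw [s₁, s₂])` for sibling records `⟨qᵢ, ·, ·, loᵢ+Kᵢ, SP[loᵢ, Kᵢ, gᵢ]⟩`;
  **`sdec_flaw_gluedTwo_append_tame`** — plus any number of TAME law-OK affordable siblings (arm-1 g57's `sdec_append_tame`).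

SCOPE / HONEST STATUS.  Width 2 only: the band of the glued-piece slice (arm-1 g58, `GluedLemmaW` / `GluedDominatedMass`) and census-1 g31's long-tail
forests concern width ≥ 3 and are untouched; `SiblingStep`, `FarTreeRow` OPEN; RATE class (log\*) / honest sentence of
`run/shared/lean/prim/quant/README.md` unchanged.  [this work]; the two-root identity is prim-quant-arm-1 g45's, the blob tools typer g40 / arm-1 g56.
Nothing here is cited as a published result.  The gluing rows served [cite: KozmaNitzan2024, Conjecture 3 (p. 15)]; product measure
[cite: Grimmett1999, §1.3 p. 10].
-/

noncomputable section

open scoped BigOperators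

namespace Summit.CriticalPhenomena.PercolationContinuityZ3.Theorems
namespace Quant
namespace LawDec

open Finset

/-- the glued sibling's sub-forest law `{lo: 1−a, lo+K: a}` in census-1's value form -/
local notation3 "SP[" lo ", " K ", " a "]" => (fun h : ℕ => (1 - (a : ℝ)) * (if h = (lo : ℕ) then (1 : ℝ) else 0) +
  (a : ℝ) * (if h = (lo : ℕ) + (K : ℕ) then (1 : ℝ) else 0))

/-! ### The sub-forest law of a glued sibling as a blob list -/

/-- top of the blob list `[(k, g), (r, 1)]` (a `k`-blob beside `r` sure relays) is `r + k`. [this work] -/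
theorem blobTop_glued (r k : ℕ) (g : ℝ) : blobTop [(k, g), (r, 1)] = r + k := by
  simp [blobTop]

/-- law facts of `blobLaw [(k, g), (r, 1)] = {r: 1−g, r+k: g}` (`0 ≤ g ≤ 1`): nonnegative, vanishing above `r + k`, mass `1`, mean `r + k·g`.
[this work] -/
theorem glued_blob_laws (r k : ℕ) {g : ℝ} (hg0 : 0 ≤ g) (hg1 : g ≤ 1) :
    (∀ h, 0 ≤ blobLaw [(k, g), (r, 1)] h) ∧ (∀ h, r + k < h → blobLaw [(k, g), (r, 1)] h = 0) ∧
      ∑ h ∈ Finset.range (r + k + 1), blobLaw [(k, g), (r, 1)] h = 1 ∧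
      ∑ h ∈ Finset.range (r + k + 1), (h : ℝ) * blobLaw [(k, g), (r, 1)] h = (r : ℝ) + k * g := by
  have hl : ∀ p ∈ [((k : ℕ), g), (r, (1 : ℝ))], 0 ≤ p.2 ∧ p.2 ≤ 1 := by
    intro p hp
    simp only [List.mem_cons, List.mem_nil_iff, or_false] at hp
    rcases hp with rfl | rfl
    · exact ⟨hg0, hg1⟩
    · exact ⟨zero_le_one, le_rfl⟩
  refine ⟨blobLaw_nonneg _ hl, fun h hh => blobLaw_eq_zero _ h (by rw [blobTop_glued]; exact hh), ?_, ?_⟩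
  · have := sum_blobLaw [((k : ℕ), g), (r, (1 : ℝ))]
    rwa [blobTop_glued] at this
  · have := sum_mul_blobLaw [((k : ℕ), g), (r, (1 : ℝ))]
    rw [blobTop_glued] at this
    rw [this]
    simp only [blobMean, zero_add, mul_one]

/-- the blob list and census-1's value form agree: `blobLaw [(K, a), (lo, 1)] = SP[lo, K, a]`. [this work] -/
theorem blobLaw_glued_eq_sp (lo K : ℕ) (a : ℝ) : blobLaw [(K, a), (lo, 1)] = SP[lo, K, a] := by
  funext h
  rw [blobLaw_pair_sure_apply, pointLaw_apply, pointLaw_apply, Nat.add_comm K lo]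

/-! ### Two glued siblings -/

/-- **TWO GLUED SIBLINGS, `q₂ ≤ q₁`**: `gate ρ₁ q₁ ∗ gate ρ₂ q₂` (`ρᵢ = {rᵢ: 1−gᵢ, rᵢ+kᵢ: gᵢ}`) is SDEC at every floor `0 < x ≤ min(q₁g₁, q₂g₂)`.
Proof: `sdec_twoRoot_of_opened` with `yᵢ = gᵢ` (`sdec_blobLaw`), opened floor `wG = x/q₁` and the opened forest
`ρ₁ ∗ gate_{q₂/q₁} ρ₂` SDEC at `x/q₁` (`sdec_gate` on `ρ₂`, then the sure block and the `g₁`-blob of `ρ₁` by `sdec_lconv_blobLaw`). [this work] -/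
theorem sdec_gluedTwo_of_le (r₁ k₁ r₂ k₂ : ℕ) {q₁ g₁ q₂ g₂ x : ℝ} (hq₁0 : 0 < q₁) (hq₁1 : q₁ < 1) (hg₁0 : 0 < g₁) (hg₁1 : g₁ < 1)
    (hq₂0 : 0 < q₂) (hg₂0 : 0 < g₂) (hg₂1 : g₂ < 1) (hq : q₂ ≤ q₁) (hx0 : 0 < x)
    (hx₁ : x ≤ q₁ * g₁) (hx₂ : x ≤ q₂ * g₂) :
    SDEC x ((r₁ + k₁) + (r₂ + k₂))
      (lconv (r₁ + k₁) (r₂ + k₂) (gate (blobLaw [(k₁, g₁), (r₁, 1)]) q₁) (gate (blobLaw [(k₂, g₂), (r₂, 1)]) q₂)) := by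
  obtain ⟨a0, aM, a1, amn⟩ := glued_blob_laws r₁ k₁ hg₁0.le hg₁1.le
  obtain ⟨b0, bM, b1, bmn⟩ := glued_blob_laws r₂ k₂ hg₂0.le hg₂1.le
  have hl₁ : ∀ p ∈ [((k₁ : ℕ), g₁), (r₁, (1 : ℝ))], g₁ ≤ p.2 ∧ p.2 ≤ 1 := by
    intro p hp
    simp only [List.mem_cons, List.mem_nil_iff, or_false] at hp
    rcases hp with rfl | rfl
    · exact ⟨le_rfl, hg₁1.le⟩
    · exact ⟨hg₁1.le, le_rfl⟩
  have hl₂ : ∀ p ∈ [((k₂ : ℕ), g₂), (r₂, (1 : ℝ))], g₂ ≤ p.2 ∧ p.2 ≤ 1 := by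
    intro p hp
    simp only [List.mem_cons, List.mem_nil_iff, or_false] at hp
    rcases hp with rfl | rfl
    · exact ⟨le_rfl, hg₂1.le⟩
    · exact ⟨hg₂1.le, le_rfl⟩
  -- the two sub-forests are SDEC at their blob gates
  have hS₁ : SDEC g₁ (r₁ + k₁) (blobLaw [(k₁, g₁), (r₁, 1)]) := by
    have := sdec_blobLaw g₁ hg₁0 hg₁1 _ hl₁
    rwa [blobTop_glued] at this
  have hS₂ : SDEC g₂ (r₂ + k₂) (blobLaw [(k₂, g₂), (r₂, 1)]) := by
    have := sdec_blobLaw g₂ hg₂0 hg₂1 _ hl₂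
    rwa [blobTop_glued] at this
  have hta₁ : g₁ * ((r₁ + k₁ : ℕ) : ℝ) ≤ ∑ h ∈ Finset.range (r₁ + k₁ + 1), (h : ℝ) * blobLaw [(k₁, g₁), (r₁, 1)] h := by
    rw [amn]; push_cast; nlinarith [Nat.cast_nonneg (α := ℝ) r₁]
  have hta₂ : g₂ * ((r₂ + k₂ : ℕ) : ℝ) ≤ ∑ h ∈ Finset.range (r₂ + k₂ + 1), (h : ℝ) * blobLaw [(k₂, g₂), (r₂, 1)] h := by
    rw [bmn]; push_cast; nlinarith [Nat.cast_nonneg (α := ℝ) r₂]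
  -- the opened floor
  set w : ℝ := x / q₁ with hw
  have hw0 : 0 < w := div_pos hx0 hq₁0
  have hwg₁ : w ≤ g₁ := by rw [hw, div_le_iff₀ hq₁0]; linarith
  have hw1 : w < 1 := lt_of_le_of_lt hwg₁ hg₁1
  have hxw : x ≤ q₁ * w := by rw [hw, mul_div_cancel₀ _ hq₁0.ne']
  -- the opened second sibling `gate ρ₂ (q₂/q₁)` is SDEC at `w`
  set q' : ℝ := q₂ / q₁ with hq'
  have hq'0 : 0 < q' := div_pos hq₂0 hq₁0
  have hq'1 : q' ≤ 1 := (div_le_one hq₁0).2 hq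
  have hρ₂w : SDEC (x / q₂) (r₂ + k₂) (blobLaw [(k₂, g₂), (r₂, 1)]) :=
    sdec_mono hS₂ (by rw [div_le_iff₀ hq₂0]; linarith) hg₂1
  have ht' : SDEC w (r₂ + k₂) (gate (blobLaw [(k₂, g₂), (r₂, 1)]) q') := by
    have := sdec_gate hρ₂w q' hq'0 hq'1
    have e : q' * (x / q₂) = w := by rw [hq', hw]; field_simp
    rwa [e] at this
  obtain ⟨u0, uM, u1⟩ := gate_laws (r₂ + k₂) (blobLaw [(k₂, g₂), (r₂, 1)]) q' hq'0.le hq'1 b0 bM b1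
  have umn : ∑ h ∈ Finset.range (r₂ + k₂ + 1), (h : ℝ) * gate (blobLaw [(k₂, g₂), (r₂, 1)]) q' h = q' * ((r₂ : ℝ) + k₂ * g₂) := by
    rw [sum_mul_gate, bmn]
  have hwq' : w ≤ q' * g₂ := by
    rw [hw, hq', div_mul_eq_mul_div, div_le_div_iff_of_pos_right hq₁0]; exact hx₂
  have hta' : w * ((r₂ + k₂ : ℕ) : ℝ) ≤ ∑ h ∈ Finset.range (r₂ + k₂ + 1), (h : ℝ) * gate (blobLaw [(k₂, g₂), (r₂, 1)]) q' h := by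
    rw [umn]; push_cast
    have h1 : w * (r₂ : ℝ) ≤ q' * r₂ := by
      have : w ≤ q' := le_trans hwq' (by nlinarith)
      exact mul_le_mul_of_nonneg_right this (Nat.cast_nonneg r₂)
    have h2 : w * (k₂ : ℝ) ≤ q' * g₂ * k₂ := mul_le_mul_of_nonneg_right hwq' (Nat.cast_nonneg k₂)
    nlinarith
  -- the opened forest: the opened sibling beside the sure block and the blob of `ρ₁`
  have hG : SDEC w ((r₁ + k₁) + (r₂ + k₂))
      (lconv (r₁ + k₁) (r₂ + k₂) (blobLaw [(k₁, g₁), (r₁, 1)]) (gate (blobLaw [(k₂, g₂), (r₂, 1)]) (q₂ / q₁))) := by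
    have hl₁w : ∀ p ∈ [((k₁ : ℕ), g₁), (r₁, (1 : ℝ))], w ≤ p.2 ∧ p.2 ≤ 1 := fun p hp => ⟨le_trans hwg₁ (hl₁ p hp).1, (hl₁ p hp).2⟩
    have := sdec_lconv_blobLaw hw0 hw1 u0 uM u1 hta' ht' _ hl₁w
    rw [blobTop_glued, lconv_comm, Nat.add_comm (r₂ + k₂) (r₁ + k₁)] at this
    rw [← hq']; exact this
  exact sdec_twoRoot_of_opened g₁ g₂ w x q₁ q₂ (r₁ + k₁) (r₂ + k₂) _ _ hg₁0 hg₁1 hg₂0 hg₂1 hw0.le hw1 hq₂0 hq hq₁1 hx0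
    a0 aM a1 hta₁ b0 bM b1 hta₂ hS₁ hS₂ hG hx₁ hx₂ hxw

/-- **EVERY WIDTH-2 FOREST OF GLUED SIBLINGS IS SDEC AT ITS NATURAL FLOOR** (any shapes, any gates, no oracle): for all `r₁ k₁ r₂ k₂`,
`0 < qᵢ < 1`, `0 < gᵢ < 1`, `0 < x ≤ min(q₁g₁, q₂g₂)`: `SDEC x ((r₁+k₁)+(r₂+k₂)) (gate ρ₁ q₁ ∗ gate ρ₂ q₂)`, `ρᵢ = blobLaw [(kᵢ, gᵢ), (rᵢ, 1)]`.
[this work] -/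
theorem sdec_gluedTwo (r₁ k₁ r₂ k₂ : ℕ) {q₁ g₁ q₂ g₂ x : ℝ} (hq₁0 : 0 < q₁) (hq₁1 : q₁ < 1) (hg₁0 : 0 < g₁) (hg₁1 : g₁ < 1)
    (hq₂0 : 0 < q₂) (hq₂1 : q₂ < 1) (hg₂0 : 0 < g₂) (hg₂1 : g₂ < 1) (hx0 : 0 < x) (hx₁ : x ≤ q₁ * g₁) (hx₂ : x ≤ q₂ * g₂) :
    SDEC x ((r₁ + k₁) + (r₂ + k₂))
      (lconv (r₁ + k₁) (r₂ + k₂) (gate (blobLaw [(k₁, g₁), (r₁, 1)]) q₁) (gate (blobLaw [(k₂, g₂), (r₂, 1)]) q₂)) := by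
  rcases le_total q₂ q₁ with hq | hq
  · exact sdec_gluedTwo_of_le r₁ k₁ r₂ k₂ hq₁0 hq₁1 hg₁0 hg₁1 hq₂0 hg₂0 hg₂1 hq hx0 hx₁ hx₂
  · have := sdec_gluedTwo_of_le r₂ k₂ r₁ k₁ hq₂0 hq₂1 hg₂0 hg₂1 hq₁0 hg₁0 hg₁1 hq hx0 hx₂ hx₁
    rwa [lconv_comm, Nat.add_comm (r₂ + k₂) (r₁ + k₁)] at this

/-! ### The light glued pair `lpT c q s` — all parameters -/

/-- the glued sibling of census-2's light pair is the gated blob list: `lpSib c q s = gate (blobLaw [(c, s), (1, 1)]) q`. [this work] -/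
theorem lpSib_eq_gate_blobLaw (c : ℕ) (q s : ℝ) : lpSib c q s = gate (blobLaw [(c, s), (1, 1)]) q := by
  rw [lpSib, blobLaw_pair_sure]

/-- **THE LIGHT GLUED PAIR IS SDEC AT ITS NATURAL FLOOR FOR ALL PARAMETERS**: `SDEC (q·s) (2c+2) (lpT c q s)` for every `c`, `0 < q < 1`,
`0 < s < 1` — including census-2 g77/g78's hull-OUT window `q ∈ (.545, .71)`, `qs ∈ ((2q−1)s, 1/2]`, `c ≥ 3`, where `TreeBuiltCatHullLight` /
`CatPairLight` are refuted in the kernel. [this work] -/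
theorem sdec_lpT_all (c : ℕ) (q s : ℝ) (hq0 : 0 < q) (hq1 : q < 1) (hs0 : 0 < s) (hs1 : s < 1) :
    SDEC (q * s) (2 * c + 2) (lpT c q s) := by
  have h := sdec_gluedTwo 1 c 1 c hq0 hq1 hs0 hs1 hq0 hq1 hs0 hs1 (mul_pos hq0 hs0) le_rfl le_rfl
  rw [← lpSib_eq_gate_blobLaw, Nat.add_comm 1 c, show c + 1 + (c + 1) = 2 * c + 2 by ring] at h
  exact h

/-- … and at every floor below: `0 < x ≤ q·s ⟹ SDEC x (2c+2) (lpT c q s)`. [this work] -/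
theorem sdec_lpT_all_of_le (c : ℕ) (q s x : ℝ) (hq0 : 0 < q) (hq1 : q < 1) (hs0 : 0 < s) (hs1 : s < 1) (hx0 : 0 < x)
    (hx : x ≤ q * s) : SDEC x (2 * c + 2) (lpT c q s) := by
  have h := sdec_gluedTwo 1 c 1 c hq0 hq1 hs0 hs1 hq0 hq1 hs0 hs1 hx0 hx hx
  rw [← lpSib_eq_gate_blobLaw, Nat.add_comm 1 c, show c + 1 + (c + 1) = 2 * c + 2 by ring] at h
  exact h

/-! ### On the node's binder: sibling records -/

/-- law-OK of a glued sibling record `⟨q, ·, ·, lo+K, SP[lo, K, g]⟩` (`0 < q < 1`, `0 ≤ g ≤ 1`). [this work] -/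
theorem lawOK_of_gluedSib (s : Sib) {lo K : ℕ} {g : ℝ} (hM : s.M = lo + K) (hq0 : 0 < s.q) (hq1 : s.q < 1) (hg0 : 0 ≤ g) (hg1 : g ≤ 1)
    (hρ : s.ρ = SP[lo, K, g]) : s.LawOK := by
  obtain ⟨c0, cM, c1, _⟩ := glued_blob_laws lo K hg0 hg1
  rw [blobLaw_glued_eq_sp] at c0 cM c1
  exact ⟨hq0, hq1, fun h => by rw [hρ]; exact c0 h, fun h hh => by rw [hρ]; exact cM h (by rw [hM] at hh; exact hh), by rw [hM, hρ]; exact c1⟩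

/-- **TWO GLUED SIBLING RECORDS: `SDEC x (ftop [s₁, s₂]) (flaw [s₁, s₂])`** for `sᵢ = ⟨qᵢ, ·, ·, loᵢ+Kᵢ, SP[loᵢ, Kᵢ, gᵢ]⟩` (`0 < qᵢ, gᵢ < 1`, any shapes) at
every floor `0 < x ≤ min qᵢgᵢ` — the node `SiblingStep` on every width-2 forest of glued siblings, unconditionally. [this work] -/
theorem sdec_flaw_gluedTwo {x : ℝ} (hx0 : 0 < x) (s₁ s₂ : Sib)
    (h₁ : 0 < s₁.q ∧ s₁.q < 1 ∧ ∃ (lo K : ℕ) (g : ℝ), s₁.M = lo + K ∧ 0 < g ∧ g < 1 ∧ s₁.ρ = SP[lo, K, g] ∧ x ≤ s₁.q * g)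
    (h₂ : 0 < s₂.q ∧ s₂.q < 1 ∧ ∃ (lo K : ℕ) (g : ℝ), s₂.M = lo + K ∧ 0 < g ∧ g < 1 ∧ s₂.ρ = SP[lo, K, g] ∧ x ≤ s₂.q * g) :
    SDEC x (ftop [s₁, s₂]) (flaw [s₁, s₂]) := by
  obtain ⟨hq₁0, hq₁1, lo₁, K₁, g₁, hM₁, hg₁0, hg₁1, hρ₁, hx₁⟩ := h₁
  obtain ⟨hq₂0, hq₂1, lo₂, K₂, g₂, hM₂, hg₂0, hg₂1, hρ₂, hx₂⟩ := h₂
  have hs₂ : s₂.LawOK := lawOK_of_gluedSib s₂ hM₂ hq₂0 hq₂1 hg₂0.le hg₂1.le hρ₂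
  have eS : flaw [s₂] = gate s₂.ρ s₂.q := by
    funext h
    show lconv 0 s₂.M (fun i => if i = 0 then (1 : ℝ) else 0) (gate s₂.ρ s₂.q) h = gate s₂.ρ s₂.q h
    refine lconv_delta_left 0 s₂.M _ (fun k hk => ?_) h
    obtain ⟨_, _, _, ρM, _⟩ := hs₂
    rw [gate_apply, ρM k hk, if_neg (by omega)]
    ring
  have eF : flaw [s₁, s₂] = lconv s₂.M s₁.M (gate s₂.ρ s₂.q) (gate s₁.ρ s₁.q) := by
    show lconv (ftop [s₂]) s₁.M (flaw [s₂]) (gate s₁.ρ s₁.q) = _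
    rw [eS]
    simp [ftop]
  have eT : ftop [s₁, s₂] = s₂.M + s₁.M := by simp [ftop]
  rw [eF, eT, hM₁, hM₂, hρ₁, hρ₂, ← blobLaw_glued_eq_sp, ← blobLaw_glued_eq_sp]
  exact sdec_gluedTwo lo₂ K₂ lo₁ K₁ hq₂0 hq₂1 hg₂0 hg₂1 hq₁0 hq₁1 hg₁0 hg₁1 hx0 hx₂ hx₁

/-- **… PLUS ANY NUMBER OF TAME SIBLINGS**: for two glued sibling records `s₁, s₂` as above and a list `Lt` of law-OK, top-affordable siblings that are
TAME at `x` (every charged `h ≥ 1` light `q·mean ≤ 2h` or floored `x(M − h) ≤ q·mean − h`): `SDEC x (ftop (Lt ++ [s₁, s₂])) (flaw (Lt ++ [s₁, s₂]))`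
(arm-1 g57's `sdec_cons_of_tame`, iterated by census-1's `sdec_append_tame`). [this work] -/
theorem sdec_flaw_gluedTwo_append_tame {x : ℝ} (hx0 : 0 < x) (s₁ s₂ : Sib)
    (h₁ : 0 < s₁.q ∧ s₁.q < 1 ∧ ∃ (lo K : ℕ) (g : ℝ), s₁.M = lo + K ∧ 0 < g ∧ g < 1 ∧ s₁.ρ = SP[lo, K, g] ∧ x ≤ s₁.q * g)
    (h₂ : 0 < s₂.q ∧ s₂.q < 1 ∧ ∃ (lo K : ℕ) (g : ℝ), s₂.M = lo + K ∧ 0 < g ∧ g < 1 ∧ s₂.ρ = SP[lo, K, g] ∧ x ≤ s₂.q * g)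
    (Lt : List Sib) (hLt : ∀ s ∈ Lt, s.LawOK) (hxLt : ∀ s ∈ Lt, x * (s.M : ℝ) ≤ s.q * s.mean)
    (htame : ∀ s ∈ Lt, ∀ h : ℕ, 1 ≤ h → s.ρ h ≠ 0 → s.q * s.mean ≤ 2 * h ∨ x * ((s.M : ℝ) - h) ≤ s.q * s.mean - h) :
    SDEC x (ftop (Lt ++ [s₁, s₂])) (flaw (Lt ++ [s₁, s₂])) := by
  have hS := sdec_flaw_gluedTwo hx0 s₁ s₂ h₁ h₂
  obtain ⟨hq₁0, hq₁1, lo₁, K₁, g₁, hM₁, hg₁0, hg₁1, hρ₁, hx₁⟩ := h₁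
  obtain ⟨hq₂0, hq₂1, lo₂, K₂, g₂, hM₂, hg₂0, hg₂1, hρ₂, hx₂⟩ := h₂
  have hx1 : x < 1 := by nlinarith
  have facts : ∀ s : Sib, ∀ (lo K : ℕ) (g : ℝ), s.M = lo + K → 0 < s.q → s.q < 1 → 0 < g → g < 1 → s.ρ = SP[lo, K, g] → x ≤ s.q * g →
      s.LawOK ∧ x * (s.M : ℝ) ≤ s.q * s.mean := by
    intro s lo K g hM hq0 hq1 hg0 hg1 hρ hx
    refine ⟨lawOK_of_gluedSib s hM hq0 hq1 hg0.le hg1.le hρ, ?_⟩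
    obtain ⟨_, _, _, cm⟩ := glued_blob_laws lo K hg0.le hg1.le
    rw [blobLaw_glued_eq_sp] at cm
    have hmean : s.mean = (lo : ℝ) + K * g := by unfold Sib.mean; rw [hM, hρ]; exact cm
    rw [hM, hmean]; push_cast
    have h1 : x * (lo : ℝ) ≤ s.q * lo := mul_le_mul_of_nonneg_right (by nlinarith) (Nat.cast_nonneg lo)
    have h2 : x * (K : ℝ) ≤ s.q * g * K := mul_le_mul_of_nonneg_right hx (Nat.cast_nonneg K)
    nlinarith
  have f₁ := facts s₁ lo₁ K₁ g₁ hM₁ hq₁0 hq₁1 hg₁0 hg₁1 hρ₁ hx₁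
  have f₂ := facts s₂ lo₂ K₂ g₂ hM₂ hq₂0 hq₂1 hg₂0 hg₂1 hρ₂ hx₂
  have hLh : ∀ t ∈ [s₁, s₂], t.LawOK := by
    intro t ht; simp only [List.mem_cons, List.mem_nil_iff, or_false] at ht
    rcases ht with rfl | rfl
    exacts [f₁.1, f₂.1]
  have hxLh : ∀ t ∈ [s₁, s₂], x * (t.M : ℝ) ≤ t.q * t.mean := by
    intro t ht; simp only [List.mem_cons, List.mem_nil_iff, or_false] at ht
    rcases ht with rfl | rfl
    exacts [f₁.2, f₂.2]
  exact sdec_append_tame hx0 hx1 [s₁, s₂] hLh hxLh hS Lt hLt hxLt htame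


/-! ### Appendix (same seat, same day): the general width-2 form — sub-forests in the blob hull -/

/-- **WIDTH 2 IS ORACLE-FREE FOR EVERY PAIR OF SIBLINGS WHOSE SUB-FOREST LAWS LIE IN THE BLOB HULL, `q₂ ≤ q₁`.**  `ρᵢ ∈ K_{yᵢ}(mᵢ)` on `{0..Mᵢ}`
(`InBlobHull yᵢ mᵢ Mᵢ ρᵢ`, `0 < yᵢ < 1`, top-affordable `yᵢ·Mᵢ ≤ mᵢ`), root gates `0 < q₂ ≤ q₁ < 1`, floor `0 < x ≤ min(q₁y₁, q₂y₂)`: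
`SDEC x (M₁+M₂) (gate ρ₁ q₁ ∗ gate ρ₂ q₂)`.  The SIBLINGS `gate ρᵢ qᵢ` need not be hull-reducible (cf. `sdec_siblings_of_reducible`, which asks that of
the gated law): every depth-1 tree (star, glued sibling, sure block with blobs) qualifies.  Proof: `sdec_twoRoot_of_opened`; sub-forests by
`sdec_of_inBlobHull`; the opened forest `ρ₁ ∗ gate_{q₂/q₁} ρ₂` by `sdec_gate` and `sdec_lconv_inBlobHull`. [this work] -/
theorem sdec_two_of_subBlobHull_of_le {y₁ y₂ m₁ m₂ q₁ q₂ x : ℝ} {M₁ M₂ : ℕ} {ρ₁ ρ₂ : ℕ → ℝ}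
    (hy₁0 : 0 < y₁) (hy₁1 : y₁ < 1) (hy₂0 : 0 < y₂) (hy₂1 : y₂ < 1) (hq₁1 : q₁ < 1) (hq₂0 : 0 < q₂) (hq : q₂ ≤ q₁)
    (hρ₁ : InBlobHull y₁ m₁ M₁ ρ₁) (hρ₂ : InBlobHull y₂ m₂ M₂ ρ₂) (hta₁ : y₁ * (M₁ : ℝ) ≤ m₁) (hta₂ : y₂ * (M₂ : ℝ) ≤ m₂)
    (hx0 : 0 < x) (hx₁ : x ≤ q₁ * y₁) (hx₂ : x ≤ q₂ * y₂) :
    SDEC x (M₁ + M₂) (lconv M₁ M₂ (gate ρ₁ q₁) (gate ρ₂ q₂)) := by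
  have hq₁0 : 0 < q₁ := lt_of_lt_of_le hq₂0 hq
  obtain ⟨a0, aM, a1⟩ := hρ₁.lawFacts hy₁0.le
  obtain ⟨b0, bM, b1⟩ := hρ₂.lawFacts hy₂0.le
  have amn := hρ₁.mean_eq
  have bmn := hρ₂.mean_eq
  have hS₁ : SDEC y₁ M₁ ρ₁ := sdec_of_inBlobHull hy₁0 hy₁1 hρ₁
  have hS₂ : SDEC y₂ M₂ ρ₂ := sdec_of_inBlobHull hy₂0 hy₂1 hρ₂
  -- the opened floor
  set w : ℝ := x / q₁ with hw
  have hw0 : 0 < w := div_pos hx0 hq₁0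
  have hwy₁ : w ≤ y₁ := by rw [hw, div_le_iff₀ hq₁0]; linarith
  have hw1 : w < 1 := lt_of_le_of_lt hwy₁ hy₁1
  have hxw : x ≤ q₁ * w := by rw [hw, mul_div_cancel₀ _ hq₁0.ne']
  -- the opened second sibling
  set q' : ℝ := q₂ / q₁ with hq'
  have hq'0 : 0 < q' := div_pos hq₂0 hq₁0
  have hq'1 : q' ≤ 1 := (div_le_one hq₁0).2 hq
  have hρ₂w : SDEC (x / q₂) M₂ ρ₂ := sdec_mono hS₂ (by rw [div_le_iff₀ hq₂0]; linarith) hy₂1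
  have ht' : SDEC w M₂ (gate ρ₂ q') := by
    have := sdec_gate hρ₂w q' hq'0 hq'1
    have e : q' * (x / q₂) = w := by rw [hq', hw]; field_simp
    rwa [e] at this
  obtain ⟨u0, uM, u1⟩ := gate_laws M₂ ρ₂ q' hq'0.le hq'1 b0 bM b1
  have umn : ∑ h ∈ Finset.range (M₂ + 1), (h : ℝ) * gate ρ₂ q' h = q' * m₂ := by rw [sum_mul_gate, bmn]
  have hwq' : w ≤ q' * y₂ := by
    rw [hw, hq', div_mul_eq_mul_div, div_le_div_iff_of_pos_right hq₁0]; exact hx₂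
  have hta' : w * (M₂ : ℝ) ≤ ∑ h ∈ Finset.range (M₂ + 1), (h : ℝ) * gate ρ₂ q' h := by
    rw [umn]
    have h1 : w * (M₂ : ℝ) ≤ q' * y₂ * M₂ := mul_le_mul_of_nonneg_right hwq' (Nat.cast_nonneg M₂)
    have h2 : q' * (y₂ * (M₂ : ℝ)) ≤ q' * m₂ := mul_le_mul_of_nonneg_left hta₂ hq'0.le
    nlinarith
  -- the opened forest
  have hG : SDEC w (M₁ + M₂) (lconv M₁ M₂ ρ₁ (gate ρ₂ (q₂ / q₁))) := by
    have := sdec_lconv_inBlobHull hw0 hw1 u0 uM u1 hta' ht' (hρ₁.mono hwy₁ le_rfl)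
    rw [lconv_comm, Nat.add_comm M₂ M₁] at this
    rw [← hq']; exact this
  refine sdec_twoRoot_of_opened y₁ y₂ w x q₁ q₂ M₁ M₂ ρ₁ ρ₂ hy₁0 hy₁1 hy₂0 hy₂1 hw0.le hw1 hq₂0 hq hq₁1 hx0
    a0 aM a1 (by rw [amn]; exact hta₁) b0 bM b1 (by rw [bmn]; exact hta₂) hS₁ hS₂ hG hx₁ hx₂ hxw

/-- **WIDTH 2, SUB-FORESTS IN THE BLOB HULL — symmetric form** (any order of the root gates). [this work] -/
theorem sdec_two_of_subBlobHull {y₁ y₂ m₁ m₂ q₁ q₂ x : ℝ} {M₁ M₂ : ℕ} {ρ₁ ρ₂ : ℕ → ℝ}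
    (hy₁0 : 0 < y₁) (hy₁1 : y₁ < 1) (hy₂0 : 0 < y₂) (hy₂1 : y₂ < 1) (hq₁0 : 0 < q₁) (hq₁1 : q₁ < 1) (hq₂0 : 0 < q₂) (hq₂1 : q₂ < 1)
    (hρ₁ : InBlobHull y₁ m₁ M₁ ρ₁) (hρ₂ : InBlobHull y₂ m₂ M₂ ρ₂) (hta₁ : y₁ * (M₁ : ℝ) ≤ m₁) (hta₂ : y₂ * (M₂ : ℝ) ≤ m₂)
    (hx0 : 0 < x) (hx₁ : x ≤ q₁ * y₁) (hx₂ : x ≤ q₂ * y₂) :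
    SDEC x (M₁ + M₂) (lconv M₁ M₂ (gate ρ₁ q₁) (gate ρ₂ q₂)) := by
  rcases le_total q₂ q₁ with hq | hq
  · exact sdec_two_of_subBlobHull_of_le hy₁0 hy₁1 hy₂0 hy₂1 hq₁1 hq₂0 hq hρ₁ hρ₂ hta₁ hta₂ hx0 hx₁ hx₂
  · have := sdec_two_of_subBlobHull_of_le hy₂0 hy₂1 hy₁0 hy₁1 hq₂1 hq₁0 hq hρ₂ hρ₁ hta₂ hta₁ hx0 hx₂ hx₁
    rwa [lconv_comm, Nat.add_comm M₂ M₁] at this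

/-- **TWO SIBLINGS WHOSE SUB-FORESTS ARE INDEPENDENT BLOBS** (gates in `[yᵢ, 1]`, any sizes, sure blocks = gate `1` allowed): for blob lists `l₁, l₂`,
`0 < yᵢ < 1`, `0 < qᵢ < 1`, `0 < x ≤ min qᵢyᵢ`: `SDEC x (blobTop l₁ + blobTop l₂) (gate (blobLaw l₁) q₁ ∗ gate (blobLaw l₂) q₂)` — two stars, two brooms of
blobs, a star beside a glued sibling, … [this work] -/
theorem sdec_two_blobSibs (l₁ l₂ : List (ℕ × ℝ)) {y₁ y₂ q₁ q₂ x : ℝ} (hy₁0 : 0 < y₁) (hy₁1 : y₁ < 1) (hy₂0 : 0 < y₂) (hy₂1 : y₂ < 1)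
    (hl₁ : ∀ p ∈ l₁, y₁ ≤ p.2 ∧ p.2 ≤ 1) (hl₂ : ∀ p ∈ l₂, y₂ ≤ p.2 ∧ p.2 ≤ 1)
    (hq₁0 : 0 < q₁) (hq₁1 : q₁ < 1) (hq₂0 : 0 < q₂) (hq₂1 : q₂ < 1) (hx0 : 0 < x) (hx₁ : x ≤ q₁ * y₁) (hx₂ : x ≤ q₂ * y₂) :
    SDEC x (blobTop l₁ + blobTop l₂) (lconv (blobTop l₁) (blobTop l₂) (gate (blobLaw l₁) q₁) (gate (blobLaw l₂) q₂)) :=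
  sdec_two_of_subBlobHull hy₁0 hy₁1 hy₂0 hy₂1 hq₁0 hq₁1 hq₂0 hq₂1 (inBlobHull_blobLaw y₁ l₁ hl₁ le_rfl) (inBlobHull_blobLaw y₂ l₂ hl₂ le_rfl)
    (floor_mul_blobTop_le y₁ l₁ fun p hp => (hl₁ p hp).1) (floor_mul_blobTop_le y₂ l₂ fun p hp => (hl₂ p hp).1) hx0 hx₁ hx₂

/-- **ON THE NODE'S BINDER**: two sibling records whose sub-forest laws are blob-hull members at floors `yᵢ` (`InBlobHull yᵢ mᵢ sᵢ.M sᵢ.ρ`, `yᵢ·Mᵢ ≤ mᵢ`,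
`0 < yᵢ < 1`, `0 < qᵢ < 1`) give an SDEC width-2 forest at every `0 < x ≤ min qᵢyᵢ`: `SDEC x (ftop [s₁, s₂]) (flaw [s₁, s₂])`. [this work] -/
theorem sdec_flaw_two_of_subBlobHull {x : ℝ} (hx0 : 0 < x) (s₁ s₂ : Sib)
    (h₁ : 0 < s₁.q ∧ s₁.q < 1 ∧ ∃ y m : ℝ, 0 < y ∧ y < 1 ∧ InBlobHull y m s₁.M s₁.ρ ∧ y * (s₁.M : ℝ) ≤ m ∧ x ≤ s₁.q * y)
    (h₂ : 0 < s₂.q ∧ s₂.q < 1 ∧ ∃ y m : ℝ, 0 < y ∧ y < 1 ∧ InBlobHull y m s₂.M s₂.ρ ∧ y * (s₂.M : ℝ) ≤ m ∧ x ≤ s₂.q * y) :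
    SDEC x (ftop [s₁, s₂]) (flaw [s₁, s₂]) := by
  obtain ⟨hq₁0, hq₁1, y₁, m₁, hy₁0, hy₁1, hρ₁, hta₁, hx₁⟩ := h₁
  obtain ⟨hq₂0, hq₂1, y₂, m₂, hy₂0, hy₂1, hρ₂, hta₂, hx₂⟩ := h₂
  obtain ⟨_, ρM, _⟩ := hρ₂.lawFacts hy₂0.le
  have eS : flaw [s₂] = gate s₂.ρ s₂.q := by
    funext h
    show lconv 0 s₂.M (fun i => if i = 0 then (1 : ℝ) else 0) (gate s₂.ρ s₂.q) h = gate s₂.ρ s₂.q h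
    refine lconv_delta_left 0 s₂.M _ (fun k hk => ?_) h
    rw [gate_apply, ρM k hk, if_neg (by omega)]
    ring
  have eF : flaw [s₁, s₂] = lconv s₂.M s₁.M (gate s₂.ρ s₂.q) (gate s₁.ρ s₁.q) := by
    show lconv (ftop [s₂]) s₁.M (flaw [s₂]) (gate s₁.ρ s₁.q) = _
    rw [eS]
    simp [ftop]
  have eT : ftop [s₁, s₂] = s₂.M + s₁.M := by simp [ftop]
  rw [eF, eT]
  exact sdec_two_of_subBlobHull hy₂0 hy₂1 hy₁0 hy₁1 hq₂0 hq₂1 hq₁0 hq₁1 hρ₂ hρ₁ hta₂ hta₁ hx0 hx₂ hx₁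

end LawDec
end Quant
end Summit.CriticalPhenomena.PercolationContinuityZ3.Theorems
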